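import Mathlib
import Literature.Computability.AlgebraicComplexity.AlderStrassen
import Summits.MatrixMultiplication.MatrixMultiplication.Theorems.FidelityWitnessesDiagonalPowerDecayTwistedCapture
import Summits.MatrixMultiplication.MatrixMultiplication.Theorems.FidelityWitnessesDiagonalPowerDecayConverseTraceNormBound

/-!
# Converse of line `frame-negativity-singlet-fraction`, part III: ASSEMBLY — the crux body implies the stub

Crux `FidelityWitnesses.DiagonalPowerDecay` (stmt-MatrixMultiplication-14053), lead prover-line-stmt-MatrixMultiplication-14053-0.
`middlePairNegativityDecay_of_body` (registered sub-goal): if `|⟨S,⟨n,n,n⟩⟩|² ≤ C n^{3−2δ} ‖S‖²` for all `S` of rank `≤ n²`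
(`δ > 0`), then for every `n²` products `u_l ⊗ v_l` and every orthonormal basis `e` of their span the stub's matrix
(`= ptr (frameOp e)`, the partially transposed middle-pair reduction) splits as `Y − Z`, `Y, Z ⪰ 0`, with
`tr Y + tr Z ≤ (1 + √(max C 1)) · n^{3 − 2(δ/4)}`.  Ingredients: `frameOp e = B Bᴴ ⪰ 0`, `tr = d ≤ n²`, its quadratic
form at `Ψ` is the `conj Ψ`-twisted capture (part `TwistedCapture`: `≤ C₁ n^{3−2δ}` for sub-unitary `Ψ`), the trace-norm
bound (part II) at `θ = C₁ n^{1−δ}`, and the final real arithmetic.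
-/

noncomputable section

-- the tree's namespace `Summit.MatrixMultiplication.MatrixMultiplication.…` repeats a component by design
set_option linter.dupNamespace false
set_option linter.unusedVariables false

namespace Summit.MatrixMultiplication.MatrixMultiplication.Theorems.DiagonalPowerDecay

open Literature.LinearAlgebra.Matrix
open Literature.Probability.RandomMatrix (nsq nsq_nonneg)


section Assembly

open scoped BigOperators ComplexConjugate ComplexOrder
open Matrix Literature.Computability.AlgebraicComplexity

variable {n d : ℕ}

/-- The (un-transposed) REDUCED MIDDLE-PAIR OPERATOR of a family `e`: `R_e = Tr_{κν} Σ_s |e_s⟩⟨e_s|`,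
`R_e (μ,μ') (λ,λ') = Σ_s Σ_{κ,ν} e_s (κ,μ) (μ',ν) · conj e_s (κ,λ) (λ',ν)`. -/
def frameOp (e : Fin d → (Fin n × Fin n) → (Fin n × Fin n) → ℂ) : Matrix (Fin n × Fin n) (Fin n × Fin n) ℂ :=
  Matrix.of fun x y => ∑ s, ∑ κ : Fin n, ∑ ν : Fin n, e s (κ, x.1) (x.2, ν) * conj (e s (κ, y.1) (y.2, ν))

/-- The flattening `B x (s,κ,ν) = e_s (κ,x.1) (x.2,ν)` with `R_e = B Bᴴ`. -/
def frameMat (e : Fin d → (Fin n × Fin n) → (Fin n × Fin n) → ℂ) :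
    Matrix (Fin n × Fin n) (Fin d × Fin n × Fin n) ℂ :=
  Matrix.of fun x j => e j.1 (j.2.1, x.1) (x.2, j.2.2)

/-- `R_e = B Bᴴ` for the flattening `B`. -/
theorem frameOp_eq_mul (e : Fin d → (Fin n × Fin n) → (Fin n × Fin n) → ℂ) :
    frameOp e = frameMat e * (frameMat e)ᴴ := by
  ext x y
  simp only [frameOp, frameMat, Matrix.mul_apply, Matrix.conjTranspose_apply, Matrix.of_apply, RCLike.star_def]
  rw [Fintype.sum_prod_type]
  refine Finset.sum_congr rfl fun s _ => ?_
  rw [Fintype.sum_prod_type]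

/-- `R_e` is positive semidefinite. -/
theorem frameOp_posSemidef (e : Fin d → (Fin n × Fin n) → (Fin n × Fin n) → ℂ) : (frameOp e).PosSemidef := by
  rw [frameOp_eq_mul]; exact Matrix.posSemidef_self_mul_conjTranspose _

/-- Its partial transpose is the line's `redPT e` (the matrix of the stub). -/
theorem ptr_frameOp (e : Fin d → (Fin n × Fin n) → (Fin n × Fin n) → ℂ) :
    ptr (frameOp e) = Matrix.of fun x y : Fin n × Fin n =>
      ∑ s, ∑ κ : Fin n, ∑ ν : Fin n, e s (κ, x.1) (y.2, ν) * conj (e s (κ, y.1) (x.2, ν)) := by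
  ext x y; rfl

/-- Its trace is the total mass of the family (`= d` for an orthonormal frame). -/
theorem frameOp_trace_re (e : Fin d → (Fin n × Fin n) → (Fin n × Fin n) → ℂ)
    (he : ∀ s t : Fin d, (∑ b, ∑ c, conj (e s b c) * e t b c) = if s = t then 1 else 0) :
    (frameOp e).trace.re = d := by
  have h1 : (frameOp e).trace = ∑ s, ∑ b : Fin n × Fin n, ∑ c : Fin n × Fin n, conj (e s b c) * e s b c := by
    unfold Matrix.trace
    calc (∑ x, (frameOp e).diag x) = ∑ x : Fin n × Fin n, ∑ s, ∑ κ : Fin n, ∑ ν : Fin n,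
          conj (e s (κ, x.1) (x.2, ν)) * e s (κ, x.1) (x.2, ν) := by
          refine Finset.sum_congr rfl fun x _ => ?_
          simp only [Matrix.diag_apply, frameOp, Matrix.of_apply]
          exact Finset.sum_congr rfl fun s _ => Finset.sum_congr rfl fun κ _ =>
            Finset.sum_congr rfl fun ν _ => mul_comm _ _
      _ = ∑ s, ∑ x : Fin n × Fin n, ∑ κ : Fin n, ∑ ν : Fin n,
          conj (e s (κ, x.1) (x.2, ν)) * e s (κ, x.1) (x.2, ν) := Finset.sum_comm
      _ = ∑ s, ∑ b : Fin n × Fin n, ∑ c : Fin n × Fin n, conj (e s b c) * e s b c := by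
          refine Finset.sum_congr rfl fun s _ => ?_
          -- Σ_{(μ,μ')} Σ_κ Σ_ν f (κ,μ) (μ',ν) = Σ_{(κ,μ)} Σ_{(μ',ν)} f
          rw [Fintype.sum_prod_type, Fintype.sum_prod_type]
          calc (∑ μ : Fin n, ∑ μ' : Fin n, ∑ κ : Fin n, ∑ ν : Fin n, conj (e s (κ, μ) (μ', ν)) * e s (κ, μ) (μ', ν))
              = ∑ μ : Fin n, ∑ κ : Fin n, ∑ μ' : Fin n, ∑ ν : Fin n, conj (e s (κ, μ) (μ', ν)) * e s (κ, μ) (μ', ν) :=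
                Finset.sum_congr rfl fun μ _ => Finset.sum_comm
            _ = ∑ κ : Fin n, ∑ μ : Fin n, ∑ μ' : Fin n, ∑ ν : Fin n, conj (e s (κ, μ) (μ', ν)) * e s (κ, μ) (μ', ν) :=
                Finset.sum_comm
            _ = _ := by
                refine Finset.sum_congr rfl fun κ _ => Finset.sum_congr rfl fun μ _ => ?_
                exact (Fintype.sum_prod_type (f := fun c : Fin n × Fin n => conj (e s (κ, μ) c) * e s (κ, μ) c)).symm
  rw [h1]
  simp_rw [he]
  simp

/-- The quadratic form of `R_e` at a vector `Ψ` is the `conj Ψ`-twisted capture of `e`. -/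
theorem frameOp_quadform (e : Fin d → (Fin n × Fin n) → (Fin n × Fin n) → ℂ) (Ψ : Fin n × Fin n → ℂ) :
    star Ψ ⬝ᵥ (frameOp e *ᵥ Ψ) = ((capTwist e (Matrix.of fun m m' => conj (Ψ (m, m'))) : ℝ) : ℂ) := by
  have hsq : ∀ z : ℂ, ((‖z‖ ^ 2 : ℝ) : ℂ) = z * conj z := fun z => by
    rw [Complex.mul_conj, Complex.normSq_eq_norm_sq, Complex.ofReal_pow]
  -- the twisted coefficient as a scalar product against Ψ
  have hco : ∀ s (κ ν : Fin n), twCoeff e (Matrix.of fun m m' => conj (Ψ (m, m'))) s (κ, ν) =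
      ∑ x : Fin n × Fin n, conj (Ψ x) * e s (κ, x.1) (x.2, ν) := by
    intro s κ ν
    rw [twCoeff, Fintype.sum_prod_type]
    exact Finset.sum_congr rfl fun m _ => Finset.sum_congr rfl fun m' _ => by
      rw [Matrix.of_apply]; ring
  symm
  calc ((capTwist e (Matrix.of fun m m' => conj (Ψ (m, m'))) : ℝ) : ℂ)
      = ∑ s, ∑ κ : Fin n, ∑ ν : Fin n, (∑ x : Fin n × Fin n, conj (Ψ x) * e s (κ, x.1) (x.2, ν)) *
          conj (∑ y : Fin n × Fin n, conj (Ψ y) * e s (κ, y.1) (y.2, ν)) := by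
        unfold capTwist
        rw [Complex.ofReal_sum]
        refine Finset.sum_congr rfl fun s _ => ?_
        rw [Complex.ofReal_sum, Fintype.sum_prod_type]
        exact Finset.sum_congr rfl fun κ _ => Finset.sum_congr rfl fun ν _ => by rw [hsq, hco]
    _ = ∑ s, ∑ κ : Fin n, ∑ ν : Fin n, ∑ x : Fin n × Fin n, ∑ y : Fin n × Fin n,
          conj (Ψ x) * (e s (κ, x.1) (x.2, ν) * conj (e s (κ, y.1) (y.2, ν)) * Ψ y) := by
        refine Finset.sum_congr rfl fun s _ => Finset.sum_congr rfl fun κ _ => Finset.sum_congr rfl fun ν _ => ?_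
        rw [map_sum, Finset.sum_mul_sum]
        refine Finset.sum_congr rfl fun x _ => Finset.sum_congr rfl fun y _ => ?_
        rw [map_mul, Complex.conj_conj]; ring
    _ = ∑ x : Fin n × Fin n, ∑ y : Fin n × Fin n, ∑ s, ∑ κ : Fin n, ∑ ν : Fin n,
          conj (Ψ x) * (e s (κ, x.1) (x.2, ν) * conj (e s (κ, y.1) (y.2, ν)) * Ψ y) := by
        -- move x, y to the front
        calc (∑ s, ∑ κ : Fin n, ∑ ν : Fin n, ∑ x : Fin n × Fin n, ∑ y : Fin n × Fin n,
              conj (Ψ x) * (e s (κ, x.1) (x.2, ν) * conj (e s (κ, y.1) (y.2, ν)) * Ψ y))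
            = ∑ s, ∑ κ : Fin n, ∑ x : Fin n × Fin n, ∑ ν : Fin n, ∑ y : Fin n × Fin n,
              conj (Ψ x) * (e s (κ, x.1) (x.2, ν) * conj (e s (κ, y.1) (y.2, ν)) * Ψ y) :=
              Finset.sum_congr rfl fun s _ => Finset.sum_congr rfl fun κ _ => Finset.sum_comm
          _ = ∑ s, ∑ x : Fin n × Fin n, ∑ κ : Fin n, ∑ ν : Fin n, ∑ y : Fin n × Fin n,
              conj (Ψ x) * (e s (κ, x.1) (x.2, ν) * conj (e s (κ, y.1) (y.2, ν)) * Ψ y) :=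
              Finset.sum_congr rfl fun s _ => Finset.sum_comm
          _ = ∑ x : Fin n × Fin n, ∑ s, ∑ κ : Fin n, ∑ ν : Fin n, ∑ y : Fin n × Fin n,
              conj (Ψ x) * (e s (κ, x.1) (x.2, ν) * conj (e s (κ, y.1) (y.2, ν)) * Ψ y) := Finset.sum_comm
          _ = ∑ x : Fin n × Fin n, ∑ s, ∑ κ : Fin n, ∑ y : Fin n × Fin n, ∑ ν : Fin n,
              conj (Ψ x) * (e s (κ, x.1) (x.2, ν) * conj (e s (κ, y.1) (y.2, ν)) * Ψ y) :=
              Finset.sum_congr rfl fun x _ => Finset.sum_congr rfl fun s _ =>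
                Finset.sum_congr rfl fun κ _ => Finset.sum_comm
          _ = ∑ x : Fin n × Fin n, ∑ s, ∑ y : Fin n × Fin n, ∑ κ : Fin n, ∑ ν : Fin n,
              conj (Ψ x) * (e s (κ, x.1) (x.2, ν) * conj (e s (κ, y.1) (y.2, ν)) * Ψ y) :=
              Finset.sum_congr rfl fun x _ => Finset.sum_congr rfl fun s _ => Finset.sum_comm
          _ = ∑ x : Fin n × Fin n, ∑ y : Fin n × Fin n, ∑ s, ∑ κ : Fin n, ∑ ν : Fin n,
              conj (Ψ x) * (e s (κ, x.1) (x.2, ν) * conj (e s (κ, y.1) (y.2, ν)) * Ψ y) :=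
              Finset.sum_congr rfl fun x _ => Finset.sum_comm
    _ = star Ψ ⬝ᵥ (frameOp e *ᵥ Ψ) := by
        simp only [dotProduct, Matrix.mulVec, frameOp, Matrix.of_apply, Pi.star_apply, RCLike.star_def,
          Finset.mul_sum, Finset.sum_mul]

/-- The final real-arithmetic step: with `t = d ≤ n²`, `M = C₁ n^{3−2δ}`, `θ = C₁ n^{1−δ}`:
`n √(t M / θ) + t √(n θ) ≤ (1 + √C₁) n^{3 − 2(δ/4)}`. -/
theorem final_arith {n : ℕ} (hn : 0 < n) {C₁ δ d : ℝ} (hC : 1 ≤ C₁) (hd0 : 0 ≤ d) (hd : d ≤ (n : ℝ) ^ 2) :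
    (n : ℝ) * Real.sqrt (d * (C₁ * (n : ℝ) ^ (3 - 2 * δ)) / (C₁ * (n : ℝ) ^ (1 - δ))) +
      d * Real.sqrt ((n : ℝ) * (C₁ * (n : ℝ) ^ (1 - δ))) ≤
      (1 + Real.sqrt C₁) * (n : ℝ) ^ (3 - 2 * (δ / 4)) := by
  have hx : (0 : ℝ) < n := Nat.cast_pos.mpr hn
  have hx0 : (0 : ℝ) ≤ n := hx.le
  have hC0 : 0 < C₁ := lt_of_lt_of_le one_pos hC
  set x : ℝ := (n : ℝ) with hxdef
  -- first term
  have h1 : d * (C₁ * x ^ (3 - 2 * δ)) / (C₁ * x ^ (1 - δ)) = d * x ^ (2 - δ) := by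
    rw [mul_div_assoc, mul_div_mul_left _ _ hC0.ne', ← Real.rpow_sub hx,
      show (3 - 2 * δ) - (1 - δ) = (2 - δ : ℝ) by ring]
  have hx2 : x ^ 2 = x ^ (2 : ℝ) := by rw [← Real.rpow_natCast]; norm_num
  have h1' : x * Real.sqrt (d * (C₁ * x ^ (3 - 2 * δ)) / (C₁ * x ^ (1 - δ))) ≤ x ^ (3 - δ / 2) := by
    rw [h1]
    calc x * Real.sqrt (d * x ^ (2 - δ)) ≤ x * Real.sqrt (x ^ 2 * x ^ (2 - δ)) := by
          refine mul_le_mul_of_nonneg_left (Real.sqrt_le_sqrt ?_) hx0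
          exact mul_le_mul_of_nonneg_right hd (Real.rpow_nonneg hx0 _)
      _ = x ^ (3 - δ / 2) := by
          rw [hx2, ← Real.rpow_add hx, Real.sqrt_eq_rpow, ← Real.rpow_mul hx0,
            show x * x ^ ((2 + (2 - δ)) * (1 / 2)) = x ^ (1 : ℝ) * x ^ ((2 + (2 - δ)) * (1 / 2)) by
              rw [Real.rpow_one], ← Real.rpow_add hx]
          congr 1; ring
  -- second term
  have h2' : d * Real.sqrt (x * (C₁ * x ^ (1 - δ))) ≤ Real.sqrt C₁ * x ^ (3 - δ / 2) := by
    have hs : Real.sqrt (x * (C₁ * x ^ (1 - δ))) = Real.sqrt C₁ * x ^ (1 - δ / 2) := by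
      rw [show x * (C₁ * x ^ (1 - δ)) = C₁ * (x ^ (1 : ℝ) * x ^ (1 - δ)) by rw [Real.rpow_one]; ring,
        ← Real.rpow_add hx, Real.sqrt_mul hC0.le, Real.sqrt_eq_rpow (x ^ _), ← Real.rpow_mul hx0]
      congr 2; ring
    rw [hs]
    calc d * (Real.sqrt C₁ * x ^ (1 - δ / 2)) ≤ x ^ 2 * (Real.sqrt C₁ * x ^ (1 - δ / 2)) :=
          mul_le_mul_of_nonneg_right hd (mul_nonneg (Real.sqrt_nonneg _) (Real.rpow_nonneg hx0 _))
      _ = Real.sqrt C₁ * x ^ (3 - δ / 2) := by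
          rw [hx2, show x ^ (2 : ℝ) * (Real.sqrt C₁ * x ^ (1 - δ / 2)) = Real.sqrt C₁ * (x ^ (2 : ℝ) * x ^ (1 - δ / 2)) by
            ring, ← Real.rpow_add hx]
          congr 2; ring
  have hexp : (3 - 2 * (δ / 4) : ℝ) = 3 - δ / 2 := by ring
  rw [hexp]
  calc x * Real.sqrt (d * (C₁ * x ^ (3 - 2 * δ)) / (C₁ * x ^ (1 - δ))) + d * Real.sqrt (x * (C₁ * x ^ (1 - δ)))
      ≤ x ^ (3 - δ / 2) + Real.sqrt C₁ * x ^ (3 - δ / 2) := add_le_add h1' h2'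
    _ = (1 + Real.sqrt C₁) * x ^ (3 - δ / 2) := by ring

/-- **The converse of the line: `DiagonalPowerDecay ⇒ stub_middlePairNegativityDecay`.** If the crux body holds
at `(C, δ)`, `δ > 0`, then the partially transposed middle-pair reduction of every `n²`-product frame splits as
`Y − Z`, `Y, Z ⪰ 0`, with `tr Y + tr Z ≤ (1 + √(max C 1)) · n^{3 − 2(δ/4)}`.  With the skeleton's
`DiagonalPowerDecay_of` (stub ⇒ crux) this makes the line's open stub EQUIVALENT to the crux. -/
theorem middlePairNegativityDecay_of_body {C δ : ℝ} (hδ : 0 < δ)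
    (hB : ∀ n : ℕ, ∀ S : (Fin n × Fin n) → (Fin n × Fin n) → (Fin n × Fin n) → ℂ, tensorRank S ≤ n ^ 2 →
      ‖∑ a, ∑ b, ∑ c, S a b c * matMulTensor ℂ n n n a b c‖ ^ 2 ≤
        C * (n : ℝ) ^ (3 - 2 * δ) * ∑ a, ∑ b, ∑ c, ‖S a b c‖ ^ 2) :
    ∃ C' δ' : ℝ, 0 < δ' ∧ ∀ (n d : ℕ) (u v : Fin (n ^ 2) → (Fin n × Fin n) → ℂ)
      (e : Fin d → (Fin n × Fin n) → (Fin n × Fin n) → ℂ), d ≤ n ^ 2 →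
      (∀ s t : Fin d, (∑ b, ∑ c, conj (e s b c) * e t b c) = if s = t then 1 else 0) →
      (∀ s, e s ∈ Submodule.span ℂ (Set.range fun l : Fin (n ^ 2) => fun b c => u l b * v l c)) →
      (∀ l : Fin (n ^ 2), (fun b c => u l b * v l c) ∈ Submodule.span ℂ (Set.range e)) →
      ∃ Y Z : Matrix (Fin n × Fin n) (Fin n × Fin n) ℂ, Y.PosSemidef ∧ Z.PosSemidef ∧
        (Matrix.of fun x y : Fin n × Fin n =>
          ∑ s, ∑ κ : Fin n, ∑ ν : Fin n, e s (κ, x.1) (y.2, ν) * conj (e s (κ, y.1) (x.2, ν))) = Y - Z ∧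
        (Y.trace + Z.trace).re ≤ C' * (n : ℝ) ^ (3 - 2 * δ') := by
  classical
  set C₁ := max C 1 with hC₁
  have hC1 : 1 ≤ C₁ := le_max_right _ _
  have hC0 : 0 ≤ C₁ := le_trans zero_le_one hC1
  -- the body with the larger constant
  have hB₁ : ∀ n : ℕ, ∀ S : (Fin n × Fin n) → (Fin n × Fin n) → (Fin n × Fin n) → ℂ, tensorRank S ≤ n ^ 2 →
      ‖∑ a, ∑ b, ∑ c, S a b c * matMulTensor ℂ n n n a b c‖ ^ 2 ≤
        C₁ * (n : ℝ) ^ (3 - 2 * δ) * ∑ a, ∑ b, ∑ c, ‖S a b c‖ ^ 2 := by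
    intro n S hS
    refine (hB n S hS).trans ?_
    have hnn : 0 ≤ (n : ℝ) ^ (3 - 2 * δ) * ∑ a, ∑ b, ∑ c, ‖S a b c‖ ^ 2 :=
      mul_nonneg (Real.rpow_nonneg (Nat.cast_nonneg n) _) (by positivity)
    rw [mul_assoc, mul_assoc]
    exact mul_le_mul_of_nonneg_right (le_max_left C 1) hnn
  refine ⟨1 + Real.sqrt C₁, δ / 4, by linarith, ?_⟩
  intro n d u v e hd he hps _hprod
  rcases Nat.eq_zero_or_pos n with hn0 | hn
  · -- n = 0: everything is empty
    subst hn0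
    refine ⟨0, 0, Matrix.PosSemidef.zero, Matrix.PosSemidef.zero, ?_, ?_⟩
    · ext x y; exact Fin.elim0 x.1
    · simp only [Matrix.trace_zero, add_zero, Complex.zero_re]
      exact mul_nonneg (by positivity) (Real.rpow_nonneg (Nat.cast_nonneg 0) _)
  -- n ≥ 1
  set R := frameOp e with hR
  have hRpsd : R.PosSemidef := frameOp_posSemidef e
  set M : ℝ := C₁ * (n : ℝ) ^ (3 - 2 * δ) with hM
  set θ : ℝ := C₁ * (n : ℝ) ^ (1 - δ) with hθ
  have hxpos : (0 : ℝ) < n := Nat.cast_pos.mpr hn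
  have hθpos : 0 < θ := mul_pos (lt_of_lt_of_le one_pos hC1) (Real.rpow_pos_of_pos hxpos _)
  have hMcap : ∀ Ψ : Fin n × Fin n → ℂ, IsSubunitary Ψ → (star Ψ ⬝ᵥ (R *ᵥ Ψ)).re ≤ M := by
    intro Ψ hΨ
    rw [hR, frameOp_quadform, Complex.ofReal_re]
    refine capTwist_le_of_body hC0 hB₁ (le_refl (n ^ 2)) u v e he hps _ ?_
    intro x
    have h := hΨ x
    unfold nsq at h
    refine le_of_eq_of_le ?_ h
    refine Finset.sum_congr rfl fun m _ => ?_
    simp only [Matrix.mulVec, dotProduct, Matrix.of_apply]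
  obtain ⟨Y, Z, hY, hZ, hsplit, htr⟩ := ptr_traceNorm_bound R hRpsd hθpos hMcap
  refine ⟨Y, Z, hY, hZ, ?_, ?_⟩
  · rw [← hsplit, hR, ptr_frameOp]
  · refine htr.trans ?_
    have ht : R.trace.re = d := frameOp_trace_re e he
    rw [ht]
    have hdle : (d : ℝ) ≤ (n : ℝ) ^ 2 := by exact_mod_cast hd
    exact final_arith hn hC1 (Nat.cast_nonneg d) hdle

end Assembly

end Summit.MatrixMultiplication.MatrixMultiplication.Theorems.DiagonalPowerDecay

end
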